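import Summits.CriticalPhenomena.PercolationContinuityZ3.Theorems.Transplant.SkelPhiForcedKitClauseC
import Summits.CriticalPhenomena.PercolationContinuityZ3.Theorems.Transplant.SkelPhiFaceKitClause
import HarnessLib

/-!
# N2 (frames-only node), (S0) kit tier, Skel side part 3: **THE FORCED KIT CLAUSE OF A FACE-FRAME WINDOW LEVEL** (`Skelφ.kitClause_frameF`) — p1-g16's
# `kitClauseF` at hp-8's face frame `ψ := pr.frame φ t I b` (the (S0) twin of `kitClause_frame`, SkelPhiFaceKitClause): quasi-steps `qSteps_frame`,
# `lip_frame`, the affine side forms `FinePrm.sideFormsU_frame` and the two placement rows the forced kit still reads (`hKC_of_affine`, `hθA_of_affine`)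

builds on p205010 (kernel theorem, internal audit signed; external expert review pending) — nothing in this file uses p205010; nothing here is a
claim about the open node `SamePDropOfSkeletonFrm₁`.
Lane `prim-bschramm`, seat `prim-bschramm-p1` (gen 17; J12/(R-35) successor, suffix `C`: no `hcol`, zone datum about `ctColEnd`); helper file (`--supports stmt-CriticalPhenomena-4575 --as helper`).
Compared with `kitClause_frame` the binder list loses the apron rows (`hd1/hD1/hD2/hℓ/hW/hKmax/hR'`, `Pex/hPex`, the zone/exit estimates, `IsSubbox`)
and gains the zone datum's rows `hzconn/hcz` (no `hcol`: J12/(R-35)) and the route at accuracy `δ³`; the conclusion is the per-level clause of `TStep.KitsAtF`.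
* **`kitClause_frameF`**.
[cite: KozmaNitzan2024, §4 Lemma 10, Steps III–IV (pp. 19–21)] [cite: MartineauTassion2017, §4.3]
-/

noncomputable section

open scoped Classical

namespace Summit.CriticalPhenomena.PercolationContinuityZ3.Theorems.Transplant

namespace Skelφ

open MeasureTheory
open Literature.Probability.Percolation Literature.Probability.LatticeModels SimpleGraph KNLevels
open Literature.Barriers.CriticalPhenomena (graphBall graphBall_finite mem_graphBall_self graphBall_mono)
open Skel (winGraph winGraph_adj winGraph_le KitGeom)
open SkelI (tanOff tanTgt tanTgt_mem)
open Literature.Probability.Percolation.KozmaNitzan.Cells (oth oth_ne eq_oth_of_ne oth_oth)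

variable {V : Type} [DecidableEq V] {G : SimpleGraph V} [G.LocallyFinite] {φ : V → Site 2}

/-- **THE FORCED KIT CLAUSE OF A FACE-FRAME WINDOW LEVEL.**  Level box `[lo − j, hi + j]` of the frame `pr.frame φ t I b` around `w₀` (radius `R`);
the lattice rooms of `kitClause_frame`; kit constants `P` (`3 ≤ P.N`, `P.A = (nz+1)·D + 1`, `d + 2 ≤ shellD`, `Rs + 1 ≤ shellD`, `(shellD+nz+1)·3 ≤ KCmax`);
short region `Rg`; the zone datum `Λc` at the kit centres (inside `Rg`, connected from the centre inside itself, containing the centre and the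
column's end); per contact: far ⇒ inner neighbour in the target; near ⇒ a zone-box vertex in the target or the route datum at accuracy `δ³`.
Conclusion: the per-level clause of `TStep.KitsAtF` for the seed data of the forced kit. [cite: KozmaNitzan2024, §4 Lemma 10, Steps III–IV] -/
theorem kitClause_frameFC [Countable V] (hlipφ : Lip G φ) (hstep : Steps G φ) {Δ : ℕ} (hΔ : ∀ v, G.degree v ≤ Δ) {q : unitInterval}
    {δ : ℝ} (hδ : 0 < δ)
    -- the face frame
    (pr : FinePrm) (t : V) (I b : Fin 2) (hD : 0 < pr.D) (hL0 : pr.c₀ * pr.L 0 ≤ pr.D)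
    (hL1 : pr.c₁ * pr.L 1 ≤ pr.D) (hc : 0 < pr.cOf I) (hA0 : pr.A ≠ 0) (hb : |pr.lvGen I (oth b)| ≤ |pr.lvGen I b|)
    (hnz : pr.lvGen I b ≠ 0) {nF : ℕ} (hnC : (nF : ℤ) ≤ pr.cOf I * |pr.A| * |pr.lvGen I b|) (hU3 : pr.D ≤ 3 * (nF : ℤ))
    -- the level box and the window
    {lo hi : Site 2} {j : ℕ} {w₀ : V} {R : ℕ}
    -- kit constants
    (P : ApronPrm) {nz Rs KCmax rs cS cU : ℕ} (hPN : 3 ≤ P.N) (hA : P.A = (nz + 1 : ℕ) * pr.D + 1)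
    (hdD : P.d + 2 ≤ shellD P) (hDρ : Rs + 1 ≤ shellD P) (hKCmax : (shellD P + nz + 1) * 3 ≤ KCmax)
    (hwide : ∀ i, (lo - (j : Site 2)) i + 2 * tanOff P.ℓs P.M ≤ (hi + (j : Site 2)) i)
    (hdw : ∀ i, (lo - (j : Site 2)) i + (P.d + 2 : ℕ) ≤ (hi + (j : Site 2)) i)
    (hDw : ∀ i, (lo - (j : Site 2)) i + ((shellD P + 1 + P.d + KCmax + Rs : ℕ) : ℤ) ≤ (hi + (j : Site 2)) i)
    (hT : (shellD P : ℤ) + KCmax + Rs ≤ tanOff P.ℓs P.M)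
    (hr₀ : P.N * (tanOff P.ℓs P.M + 2) + P.N * P.d + (KCmax + Rs) ≤ P.r₀) (hR : P.r₀ ≤ R)
    (hrs : 1 + (P.N * (tanOff P.ℓs P.M + 2) + P.N * P.d + (KCmax + Rs)) ≤ rs)
    (hcS : (P.N + 1) * (tanOff P.ℓs P.M + 1) + (P.N + 1) * P.d + (KCmax + 1) + cU ≤ cS)
    -- the short region and the zone datum at the kit centres of the frame's side forms
    (Rg : V → Finset V) (hRg : ∀ c, ∀ u ∈ Rg c, u ∈ graphBall G c Rs) (hRgcard : ∀ c, (Rg c).card ≤ cU) (hcU1 : 1 ≤ cU)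
    (Λc : V → ℕ → Finset V) (kz : ℕ) (hΛRg : ∀ c, Λc c kz ⊆ Rg c) (hzconn : ∀ c, ∀ s ∈ Λc c kz, PathIn G (↑(Λc c kz) : Set V) c s)
    (hcz : ∀ c, c ∈ Λc c kz)
    -- the level's source/support, the weighting, the region and the target
    (k : ℕ) (o : V) (Sfin : Finset V) {Wt : Sym2 V → unitInterval} {D T : Finset V}
    (hXD : winLevel G (pr.frame φ t I b) w₀ R lo hi j ⊆ D) {N : ℕ} (hN : k * (Δ + 1) ^ (2 * rs) ≤ N)
    (hk : (1 - (q : ℝ) ^ (1 + Δ * cS + cS * cU)) ^ k ≤ δ)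
    -- per contact
    (hfar : ∀ x ∈ outerBoundary (winGraph G w₀ R) (winLevel G (pr.frame φ t I b) w₀ R lo hi j),
      ¬ IsNear G (pr.frame φ t I b) (lo - (j : Site 2)) (hi + (j : Site 2)) P w₀ R x →
      ctY G (pr.frame φ t I b) w₀ R (lo - (j : Site 2)) (hi + (j : Site 2)) x ∈ T)
    (hnear : ∀ x ∈ outerBoundary (winGraph G w₀ R) (winLevel G (pr.frame φ t I b) w₀ R lo hi j),
      IsNear G (pr.frame φ t I b) (lo - (j : Site 2)) (hi + (j : Site 2)) P w₀ R x →
      (∃ u ∈ Λc (ctColEnd G (pr.sideFormsU_frame φ t I b hc hA0 hnz hD (lo - (j : Site 2)) (hi + (j : Site 2))) P w₀ R x) kz, u ∈ T) ∨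
      ∃ Qt Ft : Finset V, Ft ⊆ T ∧ Qt ⊆ D ∧
        1 - δ ^ 3 ≤ (prodBernoulli Wt).real (linkIn (↑Qt : Set V)
          (Λc (ctColEnd G (pr.sideFormsU_frame φ t I b hc hA0 hnz hD (lo - (j : Site 2)) (hi + (j : Site 2))) P w₀ R x) kz) Ft)) :
    ∃ (σ' : SData V) (S : Finset V), SHyp (winLData G (pr.frame φ t I b) w₀ R lo hi o Sfin) j σ' ∧ σ'.N ≤ N ∧
      (1 - (q : ℝ) ^ σ'.sB) ^ σ'.k ≤ δ ∧ S ⊆ D ∧ (∀ x ∈ σ'.K, σ'.face x ⊆ S) ∧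
      RelayClause (winLData G (pr.frame φ t I b) w₀ R lo hi o Sfin) Wt j σ' S T D δ := by
  set SF := pr.sideFormsU_frame φ t I b hc hA0 hnz hD (lo - (j : Site 2)) (hi + (j : Site 2)) with hSF
  have hLI : pr.cOf I * pr.L I ≤ pr.D := pr.cOf_mul_L_le hL0 hL1 I
  have hU1 : (1 : ℤ) ≤ pr.D := hD
  have hnF1 : 1 ≤ nF := by
    have h3 : (0 : ℤ) < 3 * (nF : ℤ) := lt_of_lt_of_le hD hU3
    omega
  have hnD : (nF : ℤ) ≤ pr.D := hnC.trans ((pr.cOf_abs_lvGen_le I b hc.le).trans hLI)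
  have hU : pr.D ≤ ((2 + 1 : ℕ) : ℤ) * nF := by
    have e : ((2 + 1 : ℕ) : ℤ) * nF = 3 * (nF : ℤ) := by push_cast; ring
    rw [e]; exact hU3
  have haff : ∀ (i : Fin 2) (σ₀ : ℤˣ), (SF i σ₀).IsAffine pr.D (pr.climC I b i) := fun i σ₀ => by
    rw [hSF]; exact pr.sideFormsU_frame_isAffine φ t I b hc hA0 hnz hD hLI _ _ i σ₀
  have hC : ∀ (i : Fin 2) (σ₀ : ℤˣ), (nF : ℤ) ≤ pr.climC I b i := fun i σ₀ => by
    unfold FinePrm.climC; split_ifs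
    · exact hnC
    · exact hnD
  have hA1 : 0 ≤ P.A := by rw [hA]; positivity
  have hU3' : pr.D ≤ 3 * (pr.cOf I * |pr.A| * |pr.lvGen I b|) := hU3.trans (by linarith only [hnC])
  have hq : QStepsN G (pr.frame φ t I b) P.N := (qStepsN_of_qSteps (pr.qSteps_frame hstep t I b hc hA0 hD hLI hb hnz hU3')).mono hPN
  have hKCmax' : (shellD P + nz + 1) * (2 + 1) ≤ KCmax := hKCmax
  exact kitClauseFC SF Rg (pr.lip_frame hlipφ t I b hc.le hD hLI) hq hstep hΔ hδ hwide hdw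
    (fun i σ₀ z hz _ => hKC_of_affine SF haff hU1 P hnF1 hC hU hA hKCmax' i σ₀ z hz) hA1 (hθA_of_affine SF haff hU1 P hA1 hdD)
    hr₀ hR hT hDw hDρ hRg hRgcard hcU1 hrs hcS hΛRg hzconn hcz k o Sfin hXD hN hk hfar hnear

end Skelφ

end Summit.CriticalPhenomena.PercolationContinuityZ3.Theorems.Transplant

end
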